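import Summits.BirchSwinnertonDyer.BirchSwinnertonDyer.Theorems.ThetaPartnerAtTwoSignedControlAtTwoShaThreeExtension
import Literature.NumberTheory.EllipticCurves.KummerSequenceConnecting
import HarnessLib

/-!
# The connecting map `H²(M₃) → H³(M₁)` on cocycles: exactness at `H³(M₂)`, `H³(M₁)`, `H²(M₃)` and restriction
# (degree-`3` pieces of the long exact sequence the tree's nine-term sequence stops short of; K4 `SignedControlAtTwo`, stub 3 base case)

Route `ThetaPartnerAtTwo` (TP2; crux shared with `ResidualThetaTransportAtTwo`), crux K4 `SignedControlAtTwo`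
(stmt-BirchSwinnertonDyer-20309), line `eulerchar` v14, stub `stub_realThreeOrderTwoBase` (Milne I 4.10 (c)₃ for the trivial module of
order `2`).  Seat `prover-bsd-wall-tp2-p3` (lead, gen 5).  Brick B6: the GENERIC cochain-level toolkit behind B1 (`…ShaThreeExtension`) and
B7 (`…ShaThreeBaseOfBrauer`), packaged for the two roads to the base case (B7's Kummer road `0 → μ₂ → F̄ˣ → F̄ˣ → 0`; width seat w2 g7's
Gysin road `0 → μ₂ → Ind_{F(i)}^F μ₂ → μ₂ → 0`): for a short exact sequence `0 → M₁ →ᶠ M₂ →ᵍ M₃ → 0` of discrete modules over a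
locally compact group `Γ` (§0–§3; `Γ = Γ_K` in §4), a "connecting datum" is a `3`-cocycle `a` of `M₁` and a `2`-cochain `γ` of `M₂` with `f ∘ a = dγ`
(then `g ∘ γ ∈ Z²(M₃)` and `[a] = δ₂[g ∘ γ]` in print).  No new definition is introduced (D-0026): the connecting map is handled
through such data.

* §1 `IsSES.exists_map_three_eq_of_map_three_eq_zero` — exactness at `H³(M₂)`: `g_* x = 0 ⟹ x ∈ f_* H³(M₁)`.
* §2 `IsSES.comp_mem_contTwoCocycles_of_connecting` (`g ∘ γ ∈ Z²(M₃)`), `IsSES.exists_connecting_of_map_three_eq_zero`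
  (`f_*[a] = 0 ⟹` a connecting datum `(a, γ)` exists — exactness at `H³(M₁)`, first half), `IsSES.map_three_eq_zero_of_connecting`
  (`δ₂` lands in `ker f_*`).
* §3 `IsSES.threeCocycleClass_eq_zero_of_connecting_of_mem_range` — **`δ₂ ∘ g_* = 0` with well-definedness**: if the class of
  `g ∘ γ` lies in `g_* H²(M₂)` then `[a] = 0` (exactness at `H³(M₁)` second half / at `H²(M₃)`).
* §4 `IsSES.exists_map_two_eq_res_connecting_of_res_eq_zero` — **the local criterion along any field extension `E/K`** (e.g. a
  completion `K_v`: the tree's `galoisCohomology.localization` is `galoisCohomology.res` to `Place.Completion v`): if `Res_E [a] = 0`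
  then `Res_E [g ∘ γ] ∈ (g|_E)_* H²(E, M₂)` (`DiscreteGaloisModule.resFieldHom`).
Typical use (both roads): `x ∈ H³(K, M₁)` dies in `H³(K, M₂)` ⟹ datum `(a, γ)`; `x` locally trivial ⟹ `[g∘γ]` locally in the image
of `g_*`; a Hasse principle for "`g_*`-images" in `H²(K, M₃)` ⟹ `[g∘γ] ∈ g_* H²(K, M₂)` ⟹ `x = 0` (§3).

HONEST FRAMING: THEOREMS ONLY (no definition, no named fact, no `sorry`); generic homological algebra; closes no item; BSD is not
proved by any of this.

References: [SerreGaloisCohomology1997] I §2.2–2.4 (inhomogeneous cochains, long exact sequence, functoriality);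
[MilneADT2006] I Thm. 4.10 (c).
-/

set_option autoImplicit false
-- the Theorems namespace of this sub repeats the summit name by design (D-0017 nested layout)
set_option linter.dupNamespace false

noncomputable section

open CategoryTheory NumberField Field Function
open _root_.TopRep _root_.ContRepresentation _root_.ContinuousCohomology
open Literature.NumberTheory.GaloisRepresentations
open Literature.NumberTheory.GaloisCohomology

namespace Summit.BirchSwinnertonDyer.BirchSwinnertonDyer.Theorems.SignedEC.ShaThree

universe u

section Generic

/-! Throughout §0–§3: `Γ` is any locally compact topological group (for `Γ_K` supply
`haveI := absoluteGaloisGroup_compactSpace K`), `0 → M₁ →ᶠ M₂ →ᵍ M₃ → 0` a short exact sequence of discrete `Γ`-modules. -/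

variable {Γ : Type u} [Group Γ] [TopologicalSpace Γ] [IsTopologicalGroup Γ] [LocallyCompactSpace Γ]
variable {M₁ M₂ M₃ : Type u} [AddCommGroup M₁] [TopologicalSpace M₁] [DiscreteTopology M₁]
  [AddCommGroup M₂] [TopologicalSpace M₂] [DiscreteTopology M₂]
  [AddCommGroup M₃] [TopologicalSpace M₃] [DiscreteTopology M₃]
variable {ρ₁ : ContinuousRep Γ ℤ M₁} {ρ₂ : ContinuousRep Γ ℤ M₂} {ρ₃ : ContinuousRep Γ ℤ M₃}
variable {f : ρ₁.toTopRep ⟶ ρ₂.toTopRep} {g : ρ₂.toTopRep ⟶ ρ₃.toTopRep}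

/-! ## §0 Two pointwise identities -/

omit [IsTopologicalGroup Γ] [LocallyCompactSpace Γ] in
/-- `g (dγ) = d(g ∘ γ)` for a `2`-cochain `γ` of `M₂`. [folklore] -/
theorem hom_dTwo (γ : C(Γ × Γ, M₂)) (σ τ υ : Γ) :
    g.hom (dTwo ρ₂.toTopRep γ σ τ υ) =
      dTwo ρ₃.toTopRep ((⟨g.hom, g.hom.continuous⟩ : C(M₂, M₃)).comp γ) σ τ υ := by
  rw [dTwo_apply, dTwo_apply, map_sub, map_add, map_sub, TopRep.hom_comm_apply g σ]
  rfl

omit [IsTopologicalGroup Γ] [LocallyCompactSpace Γ] in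
/-- `f (db) = d(f ∘ b)` for a `2`-cochain `b` of `M₁`. [folklore] -/
theorem hom_dTwo' (b : C(Γ × Γ, M₁)) (σ τ υ : Γ) :
    f.hom (dTwo ρ₁.toTopRep b σ τ υ) =
      dTwo ρ₂.toTopRep ((⟨f.hom, f.hom.continuous⟩ : C(M₁, M₂)).comp b) σ τ υ := by
  rw [dTwo_apply, dTwo_apply, map_sub, map_add, map_sub, TopRep.hom_comm_apply f σ]
  rfl

/-! ## §1 Exactness at `H³(M₂)` -/

/-- **Exactness at `H³(Γ_K, M₂)`**: a class of `H³(K, M₂)` killed by `g_*` comes from `H³(K, M₁)`.  (`g ∘ z = dβ`; correct the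
cocycle `z` by `dβ̃` for a continuous lift `β̃`; the corrected cocycle takes values in `ker g = im f`.)
[cite: SerreGaloisCohomology1997, I §2.2] -/
theorem IsSES.exists_map_three_eq_of_map_three_eq_zero (h : IsSES f g) (x : continuousCohomology 3 ρ₂.toTopRep)
    (hx : cohomologyMap g 3 x = 0) : ∃ a : continuousCohomology 3 ρ₁.toTopRep, cohomologyMap f 3 a = x := by
  obtain ⟨z, rfl⟩ := threeCocycleClass_surjective _ x
  rw [cohomologyMap_threeCocycleClass] at hx
  obtain ⟨β, hβ⟩ := (threeCocycleClass_eq_zero_iff_dTwo _ _).1 hx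
  have hβ' : ∀ σ τ υ, g.hom (z.1 (σ, τ, υ)) = dTwo ρ₃.toTopRep β σ τ υ := fun σ τ υ => hβ σ τ υ
  let βt : C(Γ × Γ, M₂) :=
    ⟨h.lift ∘ β, (continuous_of_discreteTopology (f := h.lift)).comp β.continuous⟩
  have hβt : (⟨g.hom, g.hom.continuous⟩ : C(M₂, M₃)).comp βt = β := ContinuousMap.ext fun p => h.g_lift _
  let dβ : contThreeCocycles ρ₂.toTopRep :=
    ⟨⟨fun p => dTwo ρ₂.toTopRep βt p.1 p.2.1 p.2.2, IsSES.continuous_dTwo βt⟩,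
      IsSES.dTwo_mem_contThreeCocycles βt⟩
  have hdβ : threeCocycleClass ρ₂.toTopRep dβ = 0 :=
    (threeCocycleClass_eq_zero_iff_dTwo _ _).2 ⟨βt, fun _ _ _ => rfl⟩
  let z' : contThreeCocycles ρ₂.toTopRep := z - dβ
  have hz'g : ∀ p, g.hom (z'.1 p) = 0 := fun ⟨σ, τ, υ⟩ => by
    change g.hom (z.1 (σ, τ, υ) - dTwo ρ₂.toTopRep βt σ τ υ) = 0
    rw [map_sub, hβ', hom_dTwo, hβt, sub_self]
  let a : contThreeCocycles ρ₁.toTopRep :=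
    ⟨⟨h.inv ∘ z'.1, (continuous_of_discreteTopology (f := h.inv)).comp z'.1.continuous⟩, fun σ τ υ ω => by
      apply h.injective
      have key := z'.2 σ τ υ ω
      change ρ₂ σ (z'.1 (τ, υ, ω)) + z'.1 (σ, τ * υ, ω) + z'.1 (σ, τ, υ) =
        z'.1 (σ * τ, υ, ω) + z'.1 (σ, τ, υ * ω) at key
      change f.hom (ρ₁ σ (h.inv (z'.1 (τ, υ, ω))) + h.inv (z'.1 (σ, τ * υ, ω)) + h.inv (z'.1 (σ, τ, υ))) =
        f.hom (h.inv (z'.1 (σ * τ, υ, ω)) + h.inv (z'.1 (σ, τ, υ * ω)))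
      rw [map_add, map_add, map_add, ContinuousRep.hom_comm_apply f σ, h.f_inv (hz'g _), h.f_inv (hz'g _),
        h.f_inv (hz'g _), h.f_inv (hz'g _), h.f_inv (hz'g _)]
      exact key⟩
  refine ⟨threeCocycleClass _ a, ?_⟩
  rw [cohomologyMap_threeCocycleClass]
  have hp : contThreeCocycles.pullback (ContinuousMonoidHom.id _) (resIdHom f) a = z' :=
    Subtype.ext (ContinuousMap.ext fun ⟨σ, τ, υ⟩ => by
      rw [pullback₃_id_resIdHom_apply]
      exact h.f_inv (hz'g _))
  rw [hp, threeCocycleClass_sub, hdβ, sub_zero]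

/-! ## §2 Connecting data -/

omit [IsTopologicalGroup Γ] [LocallyCompactSpace Γ] in
/-- **`g ∘ γ` is a `2`-cocycle of `M₃`** whenever `dγ = f ∘ a` for a `3`-cochain `a` of `M₁` (as `g ∘ f = 0`).
[cite: SerreGaloisCohomology1997, I §2.2] -/
theorem IsSES.comp_mem_contTwoCocycles_of_connecting (h : IsSES f g)
    (a : C(Γ × Γ × Γ, M₁))
    (γ : C(Γ × Γ, M₂))
    (hγ : ∀ σ τ υ, f.hom (a (σ, τ, υ)) = dTwo ρ₂.toTopRep γ σ τ υ) :
    (⟨g.hom, g.hom.continuous⟩ : C(M₂, M₃)).comp γ ∈ contTwoCocycles ρ₃.toTopRep :=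
  (mem_contTwoCocycles_iff_dTwo _ _).2 fun σ τ υ => by
    rw [← hom_dTwo, ← hγ]
    exact h.g_f_apply _

/-- **Exactness at `H³(M₁)`, existence half**: if `f_*[a] = 0` for a `3`-cocycle `a` of `M₁`, there is a `2`-cochain `γ` of `M₂`
with `f ∘ a = dγ` (so that `[a] = δ₂ [g ∘ γ]`). [cite: SerreGaloisCohomology1997, I §2.2] -/
theorem IsSES.exists_connecting_of_map_three_eq_zero (a : contThreeCocycles ρ₁.toTopRep)
    (ha : cohomologyMap f 3 (threeCocycleClass _ a) = 0) :
    ∃ γ : C(Γ × Γ, M₂), ∀ σ τ υ,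
      f.hom (a.1 (σ, τ, υ)) = dTwo ρ₂.toTopRep γ σ τ υ := by
  rw [cohomologyMap_threeCocycleClass] at ha
  obtain ⟨γ, hγ⟩ := (threeCocycleClass_eq_zero_iff_dTwo _ _).1 ha
  exact ⟨γ, fun σ τ υ => hγ σ τ υ⟩

/-- Conversely a connecting datum `f ∘ a = dγ` forces `f_*[a] = 0` (`δ₂` lands in `ker f_*`). [cite: SerreGaloisCohomology1997, I §2.2] -/
theorem IsSES.map_three_eq_zero_of_connecting (a : contThreeCocycles ρ₁.toTopRep)
    (γ : C(Γ × Γ, M₂))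
    (hγ : ∀ σ τ υ, f.hom (a.1 (σ, τ, υ)) = dTwo ρ₂.toTopRep γ σ τ υ) :
    cohomologyMap f 3 (threeCocycleClass _ a) = 0 := by
  rw [cohomologyMap_threeCocycleClass]
  exact (threeCocycleClass_eq_zero_iff_dTwo _ _).2 ⟨γ, fun σ τ υ => hγ σ τ υ⟩

/-! ## §3 `δ₂ ∘ g_* = 0`, with the well-definedness of `δ₂` built in -/

/-- **If the class of `g ∘ γ` lies in `g_* H²(K, M₂)` then `[a] = 0`** for a connecting datum `f ∘ a = dγ` (exactness at `H³(M₁)`: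
`ker f_* = im δ₂`, combined with exactness at `H²(M₃)`: `ker δ₂ = im g_*`).  Proof: `[g∘γ] = g_*[φ]` gives `g∘γ - g∘φ = dθ`;
lift `θ̃`; `γ - φ - dθ̃` takes values in `ker g = im f`, `= f ∘ b`, and `f ∘ a = dγ = f ∘ db`.
[cite: SerreGaloisCohomology1997, I §2.2] -/
theorem IsSES.threeCocycleClass_eq_zero_of_connecting_of_mem_range (h : IsSES f g) (a : contThreeCocycles ρ₁.toTopRep)
    (γ : C(Γ × Γ, M₂))
    (hγ : ∀ σ τ υ, f.hom (a.1 (σ, τ, υ)) = dTwo ρ₂.toTopRep γ σ τ υ)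
    (φ : contTwoCocycles ρ₂.toTopRep)
    (hφ : twoCocycleClass ρ₃.toTopRep ⟨(⟨g.hom, g.hom.continuous⟩ : C(M₂, M₃)).comp γ, IsSES.comp_mem_contTwoCocycles_of_connecting h a.1 γ hγ⟩ =
      cohomologyMap g 2 (twoCocycleClass ρ₂.toTopRep φ)) :
    threeCocycleClass ρ₁.toTopRep a = 0 := by
  set gC : C(M₂, M₃) := ⟨g.hom, g.hom.continuous⟩ with hgC
  rw [cohomologyMap_twoCocycleClass, ← sub_eq_zero, ← twoCocycleClass_sub] at hφ
  obtain ⟨θ, hθ⟩ := (twoCocycleClass_eq_zero_iff _ _).1 hφ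
  have hθ' : ∀ σ τ, g.hom (γ (σ, τ)) - g.hom (φ.1 (σ, τ)) = ρ₃ σ (θ τ) - θ (σ * τ) + θ σ := fun σ τ => hθ σ τ
  let θt : C(Γ, M₂) := ⟨h.lift ∘ θ, (continuous_of_discreteTopology (f := h.lift)).comp θ.continuous⟩
  have hθt : ∀ σ, g.hom (θt σ) = θ σ := fun σ => h.g_lift _
  let γ' : C(Γ × Γ, M₂) := γ - φ.1 - (ρ₂.twoCoboundary θt : contTwoCocycles _).1
  have hγ'g : ∀ p, g.hom (γ' p) = 0 := fun ⟨σ, τ⟩ => by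
    change g.hom (γ (σ, τ) - φ.1 (σ, τ) - (ρ₂ σ (θt τ) - θt (σ * τ) + θt σ)) = 0
    rw [map_sub, map_sub, map_add, map_sub, ContinuousRep.hom_comm_apply g σ, hθt, hθt, hθt, ← hθ']
    abel
  let b : C(Γ × Γ, M₁) :=
    ⟨h.inv ∘ γ', (continuous_of_discreteTopology (f := h.inv)).comp γ'.continuous⟩
  have hfb : (⟨f.hom, f.hom.continuous⟩ : C(M₁, M₂)).comp b = γ' := ContinuousMap.ext fun p => h.f_inv (hγ'g p)
  refine (threeCocycleClass_eq_zero_iff_dTwo _ _).2 ⟨b, fun σ τ υ => h.injective ?_⟩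
  rw [hγ, hom_dTwo', hfb]
  change dTwo ρ₂.toTopRep γ σ τ υ =
    dTwo ρ₂.toTopRep (γ - φ.1 - (ρ₂.twoCoboundary θt : contTwoCocycles _).1) σ τ υ
  rw [dTwo_sub, dTwo_sub, dTwo_coe_contTwoCocycles, dTwo_coe_contTwoCocycles, sub_zero, sub_zero]

end Generic

/-! ## §4 The local criterion: restriction of a connecting datum -/

section Restrict

variable {K : Type} [Field K] [CompactSpace (absoluteGaloisGroup K)]
variable {M₁ M₂ M₃ : Type} [AddCommGroup M₁] [TopologicalSpace M₁] [DiscreteTopology M₁]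
  [AddCommGroup M₂] [TopologicalSpace M₂] [DiscreteTopology M₂]
  [AddCommGroup M₃] [TopologicalSpace M₃] [DiscreteTopology M₃]
variable {ρ₁ : DiscreteGaloisModule K M₁} {ρ₂ : DiscreteGaloisModule K M₂} {ρ₃ : DiscreteGaloisModule K M₃}
variable {f : ρ₁.toTopRep ⟶ ρ₂.toTopRep} {g : ρ₂.toTopRep ⟶ ρ₃.toTopRep}
variable (E : Type) [Field E] [Algebra K E]

/-- **Along any field extension `E/K` (e.g. a completion), if `Res_E [a] = 0` then `Res_E [g ∘ γ] ∈ (g|_E)_* H²(E, M₂)`** for a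
connecting datum `f ∘ a = dγ`: `a|_E = dκ` makes `γ|_E - f ∘ κ` a `2`-cocycle of `M₂|_{Γ_E}` mapping to `(g ∘ γ)|_E`.  (For the
completions this is the localisation `galoisCohomology.localization = galoisCohomology.res`.) [cite: SerreGaloisCohomology1997, I §2.4] -/
theorem IsSES.exists_map_two_eq_res_connecting_of_res_eq_zero (h : IsSES f g) (a : contThreeCocycles ρ₁.toTopRep)
    (γ : C(absoluteGaloisGroup K × absoluteGaloisGroup K, M₂))
    (hγ : ∀ σ τ υ, f.hom (a.1 (σ, τ, υ)) = dTwo ρ₂.toTopRep γ σ τ υ)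
    (ha : galoisCohomology.res ρ₁ E 3 (threeCocycleClass _ a) = 0) :
    ∃ u' : galoisCohomology (ρ₂.restrictField E) 2,
      galoisCohomology.res ρ₃ E 2 (twoCocycleClass ρ₃.toTopRep ⟨(⟨g.hom, g.hom.continuous⟩ : C(M₂, M₃)).comp γ, IsSES.comp_mem_contTwoCocycles_of_connecting h a.1 γ hγ⟩) =
        cohomologyMap (DiscreteGaloisModule.resFieldHom E g) 2 u' := by
  haveI : CompactSpace (absoluteGaloisGroup E) := absoluteGaloisGroup_compactSpace E
  set r := absGaloisRestrict K E with hr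
  -- `Res` on explicit cocycles
  have res₂ : ∀ {N : Type} [AddCommGroup N] [TopologicalSpace N] [DiscreteTopology N]
      (τ : DiscreteGaloisModule K N) (d : contTwoCocycles τ.toTopRep),
      galoisCohomology.res τ E 2 (twoCocycleClass τ.toTopRep d) =
        twoCocycleClass (DiscreteGaloisModule.toTopRep (τ.restrictField E))
          (contTwoCocycles.pullback r (X := τ.toTopRep) (Y := DiscreteGaloisModule.toTopRep (τ.restrictField E))
            (TopRep.ofHom ⟨ContinuousLinearMap.id ℤ N, fun _ => rfl⟩) d) :=
    fun τ d ↦ map_twoCocycleClass _ _ _ d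
  have res₃ : ∀ {N : Type} [AddCommGroup N] [TopologicalSpace N] [DiscreteTopology N]
      (τ : DiscreteGaloisModule K N) (d : contThreeCocycles τ.toTopRep),
      galoisCohomology.res τ E 3 (threeCocycleClass τ.toTopRep d) =
        threeCocycleClass (DiscreteGaloisModule.toTopRep (τ.restrictField E))
          (contThreeCocycles.pullback r (X := τ.toTopRep) (Y := DiscreteGaloisModule.toTopRep (τ.restrictField E))
            (TopRep.ofHom ⟨ContinuousLinearMap.id ℤ N, fun _ => rfl⟩) d) :=
    fun τ d ↦ map_threeCocycleClass _ _ _ d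
  rw [res₃] at ha
  obtain ⟨κ, hκ⟩ : ∃ κ : C(absoluteGaloisGroup E × absoluteGaloisGroup E, M₁), ∀ σ τ υ,
      (contThreeCocycles.pullback r (X := ρ₁.toTopRep) (Y := DiscreteGaloisModule.toTopRep (ρ₁.restrictField E))
        (TopRep.ofHom ⟨ContinuousLinearMap.id ℤ M₁, fun _ => rfl⟩) a).1 (σ, τ, υ) =
      dTwo (DiscreteGaloisModule.toTopRep (ρ₁.restrictField E)) κ σ τ υ :=
    (threeCocycleClass_eq_zero_iff_dTwo _ _).1 ha
  have hκ' : ∀ σ τ υ, a.1 (r σ, r τ, r υ) = dTwo (DiscreteGaloisModule.toTopRep (ρ₁.restrictField E)) κ σ τ υ :=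
    fun σ τ υ => hκ σ τ υ
  let fC : C(M₁, M₂) := ⟨f.hom, f.hom.continuous⟩
  let γE : C(absoluteGaloisGroup E × absoluteGaloisGroup E, M₂) :=
    γ.comp ((r : C(absoluteGaloisGroup E, absoluteGaloisGroup K)).prodMap (r : C(absoluteGaloisGroup E, absoluteGaloisGroup K)))
  let φE : C(absoluteGaloisGroup E × absoluteGaloisGroup E, M₂) := γE - fC.comp κ
  have hγE : ∀ σ τ υ, dTwo (DiscreteGaloisModule.toTopRep (ρ₂.restrictField E)) γE σ τ υ =
      dTwo ρ₂.toTopRep γ (r σ) (r τ) (r υ) := fun σ τ υ => by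
    rw [dTwo_apply, dTwo_apply]
    change ρ₂ (r σ) (γ (r τ, r υ)) - γ (r (σ * τ), r υ) + γ (r σ, r (τ * υ)) - γ (r σ, r τ) = _
    rw [map_mul, map_mul]
    rfl
  have hfdE : ∀ σ τ υ, f.hom (dTwo (DiscreteGaloisModule.toTopRep (ρ₁.restrictField E)) κ σ τ υ) =
      dTwo (DiscreteGaloisModule.toTopRep (ρ₂.restrictField E)) (fC.comp κ) σ τ υ := fun σ τ υ => by
    rw [dTwo_apply, dTwo_apply, map_sub, map_add, map_sub]
    change f.hom (ρ₁ (r σ) (κ (τ, υ))) - _ + _ - _ = ρ₂ (r σ) (f.hom (κ (τ, υ))) - _ + _ - _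
    rw [ContinuousRep.hom_comm_apply f (r σ)]
    rfl
  have hφE : φE ∈ contTwoCocycles (DiscreteGaloisModule.toTopRep (ρ₂.restrictField E)) :=
    (mem_contTwoCocycles_iff_dTwo _ _).2 fun σ τ υ => by
      change dTwo (DiscreteGaloisModule.toTopRep (ρ₂.restrictField E)) (γE - fC.comp κ) σ τ υ = 0
      rw [dTwo_sub, hγE, ← hγ, ← hfdE, ← hκ', sub_self]
  refine ⟨twoCocycleClass _ ⟨φE, hφE⟩, ?_⟩
  rw [res₂, cohomologyMap_twoCocycleClass]
  refine congrArg _ (Subtype.ext (ContinuousMap.ext fun ⟨σ, τ⟩ => ?_))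
  change g.hom (γ (r σ, r τ)) = g.hom (γ (r σ, r τ) - f.hom (κ (σ, τ)))
  rw [map_sub, h.g_f_apply, sub_zero]

end Restrict

end Summit.BirchSwinnertonDyer.BirchSwinnertonDyer.Theorems.SignedEC.ShaThree

end
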